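import Mathlib
import HarnessLib
import Literature.NumberTheory.LFunctions.RiemannXiFourier

/-!
# The square norm of Riemann's kernel: `∫_ℝ |ξ(1/2 + it)|² dt = 4π ∫_ℝ Ψ(u)² du`

Helper file (`--supports stmt-RiemannHypothesis-0098`), RH-free Fourier analysis, no definitions.  Seat
rh-explicit-weil-5 gen15 (file of record `HOME/rh-explicit-weil-5/WEIL5-KAPPA.md` §1).

Context (documentation only).  The tree proves Riemann's representation `ξ(1/2 + it) = 𝓕 Ψ (t/4π)`
(`Literature…LagariasMontague.riemannXi_criticalLine_eq_fourier`) with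
`Ψ(u) = Σ_{n≥1}(2π²n⁴e^{2u} − 3πn²eᵘ)e^{u/4 − πn²eᵘ}` continuous, integrable, with integrable Fourier transform.
In the coordinate `x = √(2π)e^{u/2}` the function `(2π)^{1/4}·2κ_e·Ψ(u)` is Connes' transported pole-killed Hermite
seed `𝓔h_e(x) = x^{1/2}Σ_n h_e(nx)`, `h_e(y) = κ_e y²(y² − 3)e^{−y²/2} = h₄ − √(3/8)h₀`; hence the transport Gram norm of
WEIL5-KAPPA §1 is `‖𝓔h_e‖²_{L²(dx/x)} = 2κ_e²√(2π)∫_ℝΨ² = (κ_e²/√(2π))∫_ℝ|ξ(1/2+it)|²dt` once one knows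
`∫_ℝ|ξ(1/2+it)|²dt = 4π∫_ℝΨ²` — Plancherel for `Ψ`, proved here from Mathlib's self-adjointness formula
`∫⟪𝓕f, g⟫ = ∫⟪f, 𝓕⁻g⟫` (`VectorFourier.integral_sesq_fourierIntegral_eq_neg_flip`) and Fourier inversion:

* `integral_inner_fourier_Psic` : `∫ ⟪𝓕Ψ, 𝓕Ψ⟫ = ∫ ⟪Ψ, Ψ⟫` (complex inner products);
* `integral_norm_sq_fourier_Psic` : `∫_ℝ ‖𝓕Ψ(w)‖² dw = ∫_ℝ Ψ(u)² du`;
* `integral_norm_sq_riemannXi_criticalLine` : `∫_ℝ ‖ξ(1/2 + it)‖² dt = 4π ∫_ℝ Ψ(u)² du`.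

Standard axioms only; no `sorry`.
-/

set_option linter.dupNamespace false
set_option autoImplicit false

noncomputable section

open Real MeasureTheory Set Complex
open scoped FourierTransform InnerProductSpace

namespace Summit.RiemannHypothesis.RiemannHypothesis.Theorems.WeilRiemannKernelNormSq

open Literature.NumberTheory.LFunctions Literature.NumberTheory.LFunctions.LagariasMontague

/-- Self-adjointness + inversion: `∫ ⟪𝓕Ψ ξ, 𝓕Ψ ξ⟫ dξ = ∫ ⟪Ψ x, Ψ x⟫ dx` (complex inner products). -/
theorem integral_inner_fourier_Psic :
    ∫ ξ : ℝ, ⟪𝓕 Psic ξ, 𝓕 Psic ξ⟫_ℂ = ∫ x : ℝ, ⟪Psic x, Psic x⟫_ℂ := by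
  have key := VectorFourier.integral_sesq_fourierIntegral_eq_neg_flip (innerSL ℂ) (L := innerₗ ℝ)
    continuous_fourierChar continuous_inner integrable_Psic integrable_fourier_Psic
  simp only [flip_innerₗ, innerSL_apply_apply] at key
  have hinv : 𝓕⁻ (𝓕 Psic) = Psic :=
    continuous_Psic.fourierInv_fourier_eq integrable_Psic integrable_fourier_Psic
  have key' : ∫ ξ : ℝ, ⟪𝓕 Psic ξ, 𝓕 Psic ξ⟫_ℂ = ∫ x : ℝ, ⟪Psic x, 𝓕⁻ (𝓕 Psic) x⟫_ℂ := key
  rw [key', hinv]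

/-- **Plancherel for Riemann's kernel**: `∫_ℝ ‖𝓕Ψ(w)‖² dw = ∫_ℝ Ψ(u)² du`. -/
theorem integral_norm_sq_fourier_Psic :
    ∫ w : ℝ, ‖𝓕 Psic w‖ ^ 2 = ∫ u : ℝ, (Psi u) ^ 2 := by
  have h := integral_inner_fourier_Psic
  simp only [inner_self_eq_norm_sq_to_K] at h
  have h1 : ∫ ξ : ℝ, ((‖𝓕 Psic ξ‖ : ℂ)) ^ 2 = ((∫ ξ : ℝ, ‖𝓕 Psic ξ‖ ^ 2 : ℝ) : ℂ) := by
    rw [← integral_complex_ofReal]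
    congr 1
    funext ξ
    push_cast
    rfl
  have h2 : ∫ x : ℝ, ((‖Psic x‖ : ℂ)) ^ 2 = ((∫ x : ℝ, ‖Psic x‖ ^ 2 : ℝ) : ℂ) := by
    rw [← integral_complex_ofReal]
    congr 1
    funext x
    push_cast
    rfl
  have h3 : ∫ w : ℝ, ‖𝓕 Psic w‖ ^ 2 = ∫ x : ℝ, ‖Psic x‖ ^ 2 :=
    Complex.ofReal_injective (h1.symm.trans (h.trans h2))
  rw [h3]
  refine integral_congr_ae (ae_of_all _ fun x => ?_)
  simp only [Psic, Complex.norm_real, Real.norm_eq_abs, sq_abs]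

/-- **`∫_ℝ |ξ(1/2 + it)|² dt = 4π ∫_ℝ Ψ(u)² du`** — the `L²` norm of `Ξ` is the `L²` norm of Riemann's kernel
(Plancherel on `ξ(1/2 + it) = 𝓕Ψ(t/4π)`).  Numerically `∫_ℝ Ξ² = 2.00905`, `∫_ℝ Ψ² = 0.159873`; in the
transport normalisation this is the even Gram constant `(κ_e²/√(2π))∫Ξ² = 0.301465` of WEIL5-KAPPA §1. -/
theorem integral_norm_sq_riemannXi_criticalLine :
    ∫ t : ℝ, ‖riemannXi (1 / 2 + t * I)‖ ^ 2 = 4 * π * ∫ u : ℝ, (Psi u) ^ 2 := by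
  simp_rw [riemannXi_criticalLine_eq_fourier]
  rw [Measure.integral_comp_div (fun w => ‖𝓕 Psic w‖ ^ 2), integral_norm_sq_fourier_Psic,
    abs_of_pos (by positivity), smul_eq_mul]

end Summit.RiemannHypothesis.RiemannHypothesis.Theorems.WeilRiemannKernelNormSq

end
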